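import Summits.QuantumFields.YangMills.Theorems.UnitScaleTiltHalvingHSupURhoWindowsRho3Prelim
import HarnessLib

/-!
# `hP1room` PROGRAMME (LEAD-H BOARD «H = hSupUρ3»), row (N05-WINDOWS) in the ρ3 LETTERS: **EVERY NUMERIC WINDOW OF THE TOP-STEP CALL FROM ONE CUBIC SMALLNESS**

Route `UnitScaleTilt`, crux K1 child «MinimiserStabilityRegPr» (stmt-QuantumFields-19200), registered stub `stub_halvingStep` (`BirthV10`).  Cell `ym3-torus`
(HUMAN RULING D-0037: YM₃ on T³ is ladder rung R3 — NOT d = 4, NOT a mass gap, NOT the Clay problem); width seat `ym-t4-w13` g0 (WIDTH COPY of `ym-ust-19200-p2`);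
row named by LEAD-H ★w5-19200 g5 (16:39Z), re-lettered on his 17:27Z word.  `--supports stmt-QuantumFields-19200 --as helper`; THEOREMS ONLY (0 `def`, 0 `sorry`);
count-neutral; PURE REAL ARITHMETIC — nothing here claims `hSiteRows`, `hSupUρ3`, `hP1room`, the stub, the crux or the gap.

WHY A SECOND STATEMENT (vs ✓`HalvingHSupURhoWindows.exists_topCall_constants_of_rhoWindow`, τ₀ = 64s): the landed (K-DE) supplier
✓`P1FlatCoreTopBlocksAtMember.topTarget_of_reads` emits `‖th‖ ≤ 16·m₀·(Lᵏs₀)`, `m₀ ≍ 3(M′+ρ′)`, `Lᵏs₀ ≍ L·c⋆`, and its blocks (E) emit the `Cb`∕`Cl` values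
`640(α₄+δ+5ω)ω`, `10240·dL·(α₄+δ+11ω)` (`δ = 8(d+2)L·Lᵏs₀`, `ω = dLα₄/2`) under `160(α₄+δ+11ω) ≤ ¼`, `8·3800((d+2)L)²Lᵏs₀ ≤ 1`, `32m₀Lᵏs₀ ≤ 1`; so `τ₀` is second
order in `n := ρ′+M′+1`, the OUTPUT `B₀'` carries `L·m₀`, and Prop. 3's `h61` makes the smallness CUBIC in `n` (qw = 3; no letter grows like `c^{ρ′}`).

WHAT.  ★★ `exists_topCall_constants_of_rhoWindow₃`: for `d = 3`, `L ≥ 2`, `B₀, B₀'H > 0`, `B₂', BG, BR ≥ 0`, `cB9 > 0`, `M′ ρ′ : ℕ`, `ε₀ > 0` under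
  `10²⁹ · L¹² · (1 + B₀ + B₀⁻¹)² · ((1 + B₀'H)(1 + B₂')(1 + BG)(1 + BR))⁵ · (1 + cB9⁻¹) · ((ρ′ + M′ + 1)³·ε₀) ≤ 1`
there are `m₀ : ℕ` and reals `α₀ α₁ a₆₆ cstar B₀' α₄ C₂ cB cA cDA c' σ δ ω Cb Cl τ₀` with DISPLAYED DEFINING EQUATIONS (`m₀ = 3(M′+ρ′)+1`,
`B₀' = 300·L·m₀·(B₀'H + 15L²BG·BR + 3BG·BR·B₂')`, `σ = 2L·(cstar + a₆₆)` — the k-free letter for `Lᵏs₀`, above the datum's top-cube nearness `2L·c⋆` AND J3's base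
nearness `2L·a₆₆` —, `δ = 8·(((d+2)L : ℕ) : ℝ)·σ`, `ω = dLα₄/2`, `τ₀ = 16m₀σ`, the rest as in the τ₀ = 64s statement; `Cb`, `Cl` by BOTH floors each (the `C′₂` floors of
✓`topRows_of_datum` and the (K-DE) floors) and the ceilings `Cb ≤ α₄/(2B₀'H)`, `Cl·B₀'H ≤ ½`) and EVERY window: (2) Theorem 4's at `a := a₆₆`; (3) ✓`topRows_of_datum`'s;
(4) ✓`hSupBlock_of_topRows`', J3's and the (K-DE) windows (+ `c' ≤ σ`, `2L·cstar ≤ σ`, `2L·a₆₆ ≤ σ`, `e^{η·Lc⋆} − 1 ≤ η·σ`); (5) the seven top windows for every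
`τ ∈ [0, τ₀]`.  Generic `d` with `d = 3`.  Proof: the landed `Y_letters`∕`sizes`∕`second_order`∕`drops`∕`top106` of ✓`…WindowsPrelim`∕✓`…WindowsTop` re-read at the
inflated letter `Y′ := 400L³nY`, plus ✓`…Rho3Prelim` (`budgets₃`, `top103₃`, `letters₃`).  Elementary real arithmetic; the mathematics is in the cited files.
References: T. Bałaban, CMP **99** (1985) 75–102 [Balaban1985RegularSpaces] (Thm 4 p.88, Prop. 3 p.87, (1.99)–(1.103) p.93, Prop. 5 (1.106) p.94, Sect. E
(1.110)–(1.125) pp.95–97); CMP **98** (1985) 17–51 [Balaban1985Averaging] ((54) p.26, (203)–(214) pp.49–50); CMP **102** (1985) 277–309 [Balaban1985Variational].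
-/

set_option autoImplicit false

noncomputable section

namespace Summit.QuantumFields.YangMills.Theorems.HalvingHSupURhoWindowsRho3

open Literature.MathematicalPhysics.QuantumFieldTheory.Balaban1983to89
open B7Prop2Explicit (C0 c2')
open B7Prop3Flat (c3)
open B7Prop9Flat (C5')
open B7Prop10General (C6 C4G)
open B8Ineq125Concrete (C2p)
open B8Prop5ContractionKLevel (Mc Kc)
open HalvingHSupURhoWindowsPrelim HalvingHSupURhoWindowsTop HalvingHSupURhoWindowsRho3Prelim

set_option maxHeartbeats 400000 in
/-- ★★ **ALL NUMERIC WINDOWS OF THE TOP-STEP CALL FROM ONE CUBIC SMALLNESS, ρ3 LETTERS** (the (K-DE) target size `τ₀ = 16·m₀·σ`, `σ = Lᵏs₀ := 2L·c⋆`,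
`m₀ = 3(M′+ρ′)+1`, `σ := 2L(c⋆ + a₆₆)`; `B₀' = 300·L·m₀·(B₀'H + 15L²BG·BR + 3BG·BR·B₂')` an OUTPUT; `Cb`, `Cl` by their four floors and two ceilings; the (K-DE) windows `hbudget(σ)`,
`32m₀σ ≤ 1`, `160(α₄+δ+11ω) ≤ ¼`; (2) = Theorem 4's windows at `a := a₆₆`, (3) = `topRows_of_datum`'s, (4) = `hSupBlock_of_topRows`' + J3's + (K-DE)'s, (5) = the
seven top windows for every `τ ∈ [0, τ₀]`).  Generic `d` with `d = 3`. [cite: Balaban1985RegularSpaces, Thm 4 p.88, Prop. 3 p.87, (1.103) p.93, Prop. 5 (1.106) p.94, Sect. E (1.110)-(1.125) pp.95-97; Balaban1985Averaging, (54) p.26, (203)-(214) pp.49-50; Balaban1985Variational, (150)-(168) pp.301-304] -/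
theorem exists_topCall_constants_of_rhoWindow₃ (d L : ℕ) (hd : d = 3) (hL : 2 ≤ L)
    {B₀ B₀'H B₂' BG BR cB9 : ℝ} (hB₀ : 0 < B₀) (hB₀'H : 0 < B₀'H) (hB₂' : 0 ≤ B₂') (hBG : 0 ≤ BG) (hBR : 0 ≤ BR) (hcB9 : 0 < cB9)
    (M' ρ' : ℕ) {ε₀ : ℝ} (hε₀ : 0 < ε₀)
    (hw : (10 : ℝ) ^ 29 * (L : ℝ) ^ 12 * (1 + B₀ + B₀⁻¹) ^ 2 * ((1 + B₀'H) * (1 + B₂') * (1 + BG) * (1 + BR)) ^ 5 * (1 + cB9⁻¹) *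
      (((ρ' : ℝ) + M' + 1) ^ 3 * ε₀) ≤ 1) :
    ∃ (m₀ : ℕ) (α₀ α₁ a₆₆ cstar B₀' α₄ C₂ cB cA cDA c' σ δ ω Cb Cl τ₀ : ℝ),
      -- (0) the defining equations
      m₀ = 3 * (M' + ρ') + 1 ∧ α₀ = ε₀ ∧ a₆₆ = 198 * ε₀ + 12 * ((M' : ℝ) - 1 + 4 * ρ') * ε₀ ∧
      α₁ = 198 * (((ρ' : ℝ) + M' + 1) * ε₀) + 27 * (((ρ' : ℝ) + M' + 1) * ε₀) / ((L : ℝ) * B₀) ∧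
      cstar = 5 * d * L * B₀ * (α₀ + α₁) ∧ B₀' = 300 * (L : ℝ) * m₀ * (B₀'H + 15 * (L : ℝ) ^ 2 * BG * BR + 3 * BG * BR * B₂') ∧
      α₄ = 8 * B₀' * (5 * (d : ℝ) * L * B₀) * (α₀ + α₁) ∧ C₂ = 16 * (131072 * ((d : ℝ) + 1) ^ 2) ∧
      cB = L * cstar ∧ cA = L * cstar ∧ cDA = (d : ℝ) * (L : ℝ) ^ 2 * cstar ∧ c' = 2 * cstar ∧ σ = 2 * L * (cstar + a₆₆) ∧
      δ = 8 * ((((d + 2) * L : ℕ)) : ℝ) * σ ∧ ω = (d : ℝ) * L * α₄ / 2 ∧ τ₀ = 16 * m₀ * σ ∧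
      -- (1) signs and order
      (1 ≤ m₀ ∧ 0 < α₀ ∧ 0 < α₁ ∧ 0 ≤ α₁ ∧ a₆₆ ≤ α₁ ∧ 198 * ε₀ + 12 * ((M' : ℝ) - 1 + 4 * ρ') * ε₀ ≤ a₆₆ ∧ 0 < B₀' ∧ 0 ≤ α₄ ∧ 0 < α₄ ∧
        0 ≤ B₀ ∧ 0 ≤ cstar ∧ 0 ≤ Cb ∧ 0 ≤ Cl ∧ 0 ≤ c' ∧ 0 ≤ cA ∧ 0 ≤ σ ∧ 0 ≤ δ ∧ 0 ≤ ω ∧ 0 < τ₀) ∧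
      -- (2) Theorem 4's windows ((a) = (c)), with `a := a₆₆`
      (α₄ ≤ 1 / 84 ∧ L * cstar ≤ 1 / 12 ∧ a₆₆ ≤ 1 / 4 ∧ 2 * a₆₆ ≤ cstar ∧ C0 d * α₀ ≤ 1 / 3 ∧ 4 * α₀ ≤ c2' d L ∧
        16 * (2 * (L * cstar) + 8 * α₄) ≤ 1 ∧ 5 * (2 * (L * cstar) + 8 * α₄) * ((d : ℝ) - 1) ≤ 4 ∧
        Real.exp (4 * (800 * ((d : ℝ) + 1) ^ 2 * ((d : ℝ) + 4)) * α₀)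
          * (1 + 8 * (131072 * ((d : ℝ) + 1) ^ 2) * (2 * (L * cstar) + 8 * α₄)) ≤ 2 ∧
        2 * (2 * (L * cstar) + 8 * α₄) ≤ c3 d L ∧ 36 * d * B₀ * (2 * (L * cstar) + 8 * α₄) ≤ 1 / 2 ∧
        50 * d * (2 * (L * cstar) + 8 * α₄) ≤ 1 ∧
        8 * (131072 * ((d : ℝ) + 1) ^ 2) * Real.exp (4 * (800 * ((d : ℝ) + 1) ^ 2 * ((d : ℝ) + 4)) * α₀) ≤ C₂ ∧
        2 * (2 * (L * cstar) + 8 * α₄) ^ 2 + 20 * d * α₀ * (2 * (L * cstar) + 8 * α₄)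
          + 2 * C₂ * (2 * (L * cstar) + 8 * α₄) ^ 2 ≤ α₀ + α₁) ∧
      -- (3) `topRows_of_datum`'s scalar windows ((b)), `Cb`∕`Cl` by their floors (C′₂-floor and (K-DE)-floor each) and ceilings
      (α₀ ≤ cB9 ∧ cstar ≤ cB9 ∧ 36 * d * B₀ * cstar ≤ 1 / 2 ∧
        2 * cstar ^ 2 + 20 * d * α₀ * cstar + 2 * C₂ * cstar ^ 2 ≤ α₀ + α₁ ∧ (d : ℝ) * L * α₁ ≤ 1 / 8 ∧
        L * cstar ≤ cB ∧ L * cstar ≤ cA ∧ (d : ℝ) * (L : ℝ) ^ 2 * cstar ≤ cDA ∧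
        Real.exp (4 * (800 * ((d : ℝ) + 1) ^ 2 * ((d : ℝ) + 4)) * α₀) * (1 + 8 * (131072 * ((d : ℝ) + 1) ^ 2) * cB) ≤ 2 ∧
        2 * cB ≤ c3 d L ∧ 2048 * (d : ℝ) * cB ≤ 1 ∧ 40 * d * cB ≤ 1 / 200 ∧
        200 * C6 d * (2 * α₄) ≤ 1 ∧ 12000 * ((d : ℝ) + 1) * L * (2 * α₄) ≤ 1 ∧
        C4G d L * (α₀ + 40 * d * cB + 4 * (2 * α₄)) ≤ 1 ∧
        1024 * ((d : ℝ) + 1) * ((d : ℝ) + 4) * (L : ℝ) ^ 2 * α₀ ≤ 1 ∧ 32 * ((d : ℝ) + 1) ^ 2 * C6 d * (L : ℝ) ^ 2 * α₀ ≤ 1 ∧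
        16 * d * C5' d * C6 d * (L : ℝ) ^ 2 * α₀ ≤ 1 ∧ 8 * d * C6 d * L * α₀ ≤ 1 ∧
        2 * C6 d * (40 * d * cB + 4 * α₄) ≤ 1 / 8 ∧ cA ≤ 1 / 13 ∧
        C2p d * (40 * d * cB + α₄) * α₄ ≤ Cb ∧ 640 * (α₄ + δ + 5 * ω) * ω ≤ Cb ∧
        2 * C2p d * (40 * d * cB + 2 * α₄) ≤ Cl ∧ 10240 * ((d : ℝ) * L) * (α₄ + δ + 11 * ω) ≤ Cl ∧
        Cb ≤ α₄ / (2 * B₀'H) ∧ Cl * B₀'H ≤ 1 / 2) ∧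
      -- (4) `hSupBlock_of_topRows`' windows ((d)), J3's, and the (K-DE) windows of `P1FlatCoreTopBlocksAtMember`
      (α₄ ≤ 1 / 70 ∧ cA ≤ 1 / 12 ∧ 8 * 3800 * ((((d + 2) * L : ℕ) : ℝ)) ^ 2 * c' ≤ 1 ∧
        (∀ η : ℝ, 0 ≤ η → η ≤ 1 → Real.exp (η * cstar) - 1 ≤ η * c') ∧
        C0 d * (2 * ε₀) ≤ 1 / 3 ∧ 2 * (2 * ε₀) ≤ c2' d L ∧ a₆₆ ≤ 1 / 6 ∧
        c' ≤ σ ∧ 2 * L * cstar ≤ σ ∧ 2 * L * a₆₆ ≤ σ ∧ (∀ η : ℝ, 0 ≤ η → η ≤ 1 → Real.exp (η * (L * cstar)) - 1 ≤ η * σ) ∧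
        8 * 3800 * ((((d + 2) * L : ℕ) : ℝ)) ^ 2 * σ ≤ 1 ∧ 32 * (m₀ : ℝ) * σ ≤ 1 ∧ 160 * (α₄ + δ + 11 * ω) ≤ 1 / 4) ∧
      -- (5) the seven top windows, for every `τ ∈ [0, τ₀]`
      (∀ τ : ℝ, 0 ≤ τ → τ ≤ τ₀ →
        B₀'H * τ < α₄ / 4 ∧ α₄ / 4 + B₀'H * (Cb + τ) ≤ 1 / 24 ∧ α₄ / 4 + B₀'H * (Cb + τ) ≤ 1 / 140 ∧
        10 * (α₄ / 4 + B₀'H * (Cb + τ)) * BR ≤ 1 / 2 ∧ B₀'H * (Cb + τ) ≤ 3 * α₄ / 4 ∧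
        BG * Mc d BR (α₄ / 4 + B₀'H * (Cb + τ)) cA (B₂' * (Cb + τ)) cDA ≤ α₄ / 4 ∧
        BG * Kc d BR (α₄ / 4 + B₀'H * (Cb + τ)) cA (B₂' * (Cb + τ)) cDA (B₂' * (2 * Cl)) (1 + B₀'H * (2 * Cl)) (1 + B₀'H * (2 * Cl))
          ≤ 1 / 2) := by
  subst hd
  -- letters
  set ℓ : ℝ := (L : ℝ) with hℓdef
  have hℓ2 : (2 : ℝ) ≤ ℓ := by rw [hℓdef]; exact_mod_cast hL
  have hℓ1 : (1 : ℝ) ≤ ℓ := by linarith only [hℓ2]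
  have hℓ0 : (0 : ℝ) ≤ ℓ := by linarith only [hℓ2]
  have hρ0 : (0 : ℝ) ≤ ρ' := Nat.cast_nonneg _
  have hM0 : (0 : ℝ) ≤ M' := Nat.cast_nonneg _
  obtain ⟨n, hn⟩ : ∃ n : ℝ, n = (ρ' : ℝ) + M' + 1 := ⟨_, rfl⟩
  have hn1 : 1 ≤ n := by rw [hn]; linarith only [hρ0, hM0]
  have hn0 : 0 ≤ n := by linarith only [hn1]
  obtain ⟨s, hs⟩ : ∃ s : ℝ, s = n * ε₀ := ⟨_, rfl⟩
  have hs0 : 0 < s := by rw [hs]; positivity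
  have hεs : ε₀ ≤ s := by rw [hs]; have := mul_nonneg (sub_nonneg.mpr hn1) hε₀.le; linarith only [this]
  obtain ⟨X₀, hX₀⟩ : ∃ X₀ : ℝ, X₀ = 1 + B₀ + B₀⁻¹ := ⟨_, rfl⟩
  obtain ⟨Y, hY⟩ : ∃ Y : ℝ, Y = (1 + B₀'H) * (1 + B₂') * (1 + BG) * (1 + BR) := ⟨_, rfl⟩
  have hBinv0 : 0 < B₀⁻¹ := inv_pos.mpr hB₀
  have hX₀1 : 1 ≤ X₀ := by rw [hX₀]; linarith only [hB₀.le, hBinv0.le]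
  have hX₀0 : 0 ≤ X₀ := by linarith only [hX₀1]
  have hB₀X : B₀ ≤ X₀ := by rw [hX₀]; linarith only [hBinv0.le]
  have hBiX : B₀⁻¹ ≤ X₀ := by rw [hX₀]; linarith only [hB₀.le]
  obtain ⟨hY1, hB₀'HY, hB₂'Y, hBGY, hBRY, hBGBRY, hBGBRBY, hYlow⟩ := Y_letters hB₀'H.le hB₂' hBG hBR hY
  have hY0 : 0 ≤ Y := by linarith only [hY1]
  obtain ⟨c, hc⟩ : ∃ c : ℝ, c = cB9⁻¹ := ⟨_, rfl⟩
  have hc0 : 0 ≤ c := by rw [hc]; exact (inv_pos.mpr hcB9).le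
  have hW : (10 : ℝ) ^ 29 * ℓ ^ 12 * X₀ ^ 2 * Y ^ 5 * (1 + c) * (n ^ 2 * s) ≤ 1 := by
    have h : n ^ 2 * s = ((ρ' : ℝ) + M' + 1) ^ 3 * ε₀ := by rw [hs, hn]; ring
    rw [hX₀, hY, hc, h]; exact hw
  obtain ⟨hB1, hB3, hB4, hB5, hB6, hB7, hB9, hB10, hs1⟩ := budgets₃ hℓ1 hX₀1 hY1 hc0 hn1 hs0.le hW
  -- the inflated letter `Y′ := 400ℓ³nY`
  obtain ⟨Y', hY'⟩ : ∃ y : ℝ, y = 400 * ℓ ^ 3 * n * Y := ⟨_, rfl⟩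
  have hYY' : Y ≤ Y' := by
    rw [hY']
    have h1 : (1 : ℝ) ≤ 400 * ℓ ^ 3 * n := by
      have := one_le_mul_of_one_le_of_one_le (one_le_pow₀ hℓ1 : (1 : ℝ) ≤ ℓ ^ 3) hn1; nlinarith only [this]
    have := mul_le_mul_of_nonneg_right h1 hY0; linarith only [this]
  have hY'1 : 1 ≤ Y' := hY1.trans hYY'
  have hB₀'HY' : B₀'H ≤ Y' := hB₀'HY.trans hYY'
  rw [← hY'] at hB3 hB4 hB5 hB6
  -- the base letters and their sizes (the landed `sizes` at the base `B₀'♭`)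
  obtain ⟨a₆₆, ha₆₆⟩ : ∃ a : ℝ, a = 198 * ε₀ + 12 * ((M' : ℝ) - 1 + 4 * ρ') * ε₀ := ⟨_, rfl⟩
  obtain ⟨α₁, hα₁⟩ : ∃ a : ℝ, a = 198 * s + 27 * s / (ℓ * B₀) := ⟨_, rfl⟩
  obtain ⟨cstar, hcs⟩ : ∃ x : ℝ, x = 15 * ℓ * B₀ * (ε₀ + α₁) := ⟨_, rfl⟩
  obtain ⟨B₀'b, hB₀'b⟩ : ∃ b : ℝ, b = B₀'H + 15 * ℓ ^ 2 * BG * BR + 3 * BG * BR * B₂' := ⟨_, rfl⟩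
  obtain ⟨α₄b, hα₄b⟩ : ∃ a : ℝ, a = 8 * B₀'b * cstar := ⟨_, rfl⟩
  obtain ⟨cB, hcB⟩ : ∃ x : ℝ, x = ℓ * cstar := ⟨_, rfl⟩
  obtain ⟨cDA, hcDA⟩ : ∃ x : ℝ, x = 3 * ℓ ^ 2 * cstar := ⟨_, rfl⟩
  obtain ⟨Clb, hClb⟩ : ∃ x : ℝ, x = 2 * 579944448 * (120 * cB + 2 * α₄b) := ⟨_, rfl⟩
  obtain ⟨hα₁L, hα₁U, hcsL, hcsU, hcs0, hbL1, hbL2, hbL3, hbU, hb0, -, -, -, hcBU, hcDAU, -, -, -, hV0, hcsV⟩ :=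
    sizes hℓ1 hB₀ hX₀1 hB₀X hBiX hY1 hB₀'H hB₂' hBG hBR hYlow hs0 hε₀ hεs hα₁ hcs hB₀'b hα₄b hcB hcDA hClb
  have hcB0 : 0 ≤ cB := by rw [hcB]; positivity
  have hcDA0 : 0 ≤ cDA := by rw [hcDA]; positivity
  -- `m₀` and the ρ3 letters
  obtain ⟨m, hm⟩ : ∃ m : ℝ, m = ((3 * (M' + ρ') + 1 : ℕ) : ℝ) := ⟨_, rfl⟩
  have hmE : m = 3 * ((M' : ℝ) + ρ') + 1 := by rw [hm]; push_cast; ring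
  have hm1 : 1 ≤ m := by rw [hmE]; linarith only [hρ0, hM0]
  have hm0 : 0 ≤ m := by linarith only [hm1]
  have hm3 : m ≤ 3 * n := by rw [hmE, hn]; linarith only [hρ0]
  obtain ⟨B₀', hB₀'⟩ : ∃ b : ℝ, b = 300 * ℓ * m * B₀'b := ⟨_, rfl⟩
  obtain ⟨α₄, hα₄⟩ : ∃ a : ℝ, a = 8 * B₀' * cstar := ⟨_, rfl⟩
  have ha66L : 0 ≤ a₆₆ := by
    rw [ha₆₆]; nlinarith only [hε₀, hρ0, hM0]
  have ha66U : a₆₆ ≤ 198 * s := by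
    rw [ha₆₆, hs, hn]
    have e1 := mul_nonneg hM0 hε₀.le
    have e2 := mul_nonneg hρ0 hε₀.le
    linarith only [e1, e2, hε₀]
  obtain ⟨σ, hσ⟩ : ∃ x : ℝ, x = 2 * ℓ * (cstar + a₆₆) := ⟨_, rfl⟩
  obtain ⟨δ, hδ⟩ : ∃ x : ℝ, x = 40 * ℓ * σ := ⟨_, rfl⟩
  obtain ⟨ω, hω⟩ : ∃ x : ℝ, x = 3 * ℓ * α₄ / 2 := ⟨_, rfl⟩
  obtain ⟨τ₀, hτ₀⟩ : ∃ t : ℝ, t = 16 * m * σ := ⟨_, rfl⟩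
  obtain ⟨Cl, hCl⟩ : ∃ x : ℝ, x = 2 * 579944448 * (120 * cB + 2 * α₄) + 10240 * (3 * ℓ) * (α₄ + δ + 11 * ω) := ⟨_, rfl⟩
  obtain ⟨Cb₁, hCb₁⟩ : ∃ x : ℝ, x = 579944448 * (120 * cB + α₄) * α₄ := ⟨_, rfl⟩
  obtain ⟨Cb₂, hCb₂⟩ : ∃ x : ℝ, x = 640 * (α₄ + δ + 5 * ω) * ω := ⟨_, rfl⟩
  obtain ⟨Cb, hCb⟩ : ∃ x : ℝ, x = Cb₁ + Cb₂ := ⟨_, rfl⟩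
  obtain ⟨C₂, hC₂⟩ : ∃ x : ℝ, x = 33554432 := ⟨_, rfl⟩
  obtain ⟨hB₀'0, hB₀'L1, hα₄0, hα₄U, hσ0, hσU, ⟨hσL, hσLa⟩, hδ0, hδU, hω0, hωU, hτ₀0, hτ₀E, hτ₀U, htU, hQU, hCl0, hClU, hCb₂0, hCb₂U, hCb₂E, hsum,
      hsh1, hsh2, hsh3, hsV₄, hcBV₄, hcDAV₄⟩ :=
    letters₃ hℓ1 hX₀1 hY1 hBG hBR hB₂' hB₀'H hn1 hs0 hεs hm1 hm3 ha66L ha66U hcs0 hcsL hcsU hb0 hbU hbL1 hbL2 hbL3 hB₀' hα₄ hσ hδ hω hτ₀ hcB hcDA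
      hCl hCb₂
  set V₄ : ℝ := ℓ ^ 4 * X₀ * Y * n * s with hV₄
  have hV₄0 : 0 ≤ V₄ := by positivity
  obtain ⟨V', hV'⟩ : ∃ v : ℝ, v = ℓ ^ 3 * X₀ * Y' * s := ⟨_, rfl⟩
  have hV'E : V' = 400 * ℓ ^ 2 * V₄ := by rw [hV', hY', hV₄]; ring
  have hℓsq2 : 2 ≤ ℓ ^ 2 := by nlinarith only [hℓ2]
  have hV₄V' : 2 * 10 ^ 8 * V₄ ≤ 10 ^ 6 * V' := by
    rw [hV'E]; have := mul_le_mul_of_nonneg_right hℓsq2 hV₄0; linarith only [this, hV₄0]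
  have hℓsq4 : 4 ≤ ℓ ^ 2 := by nlinarith only [hℓ2]
  have hℓ4 : (16 : ℝ) ≤ ℓ ^ 4 := by
    have e : ℓ ^ 4 = ℓ ^ 2 * ℓ ^ 2 := by ring
    have := mul_le_mul hℓsq4 hℓsq4 (by norm_num) (by positivity)
    rw [e]; linarith only [this]
  have hV₄V'' : V₄ ≤ V' := by linarith only [hV₄V', hV₄0]
  have hsV' : s ≤ V' := hsV₄.trans hV₄V''
  -- `second_order` and `drops` re-read at `Y′`
  obtain ⟨hCb₁0, hCb₁U, -, h61a, h61b⟩ :=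
    second_order (Cb := Cb₁) hℓ1 hX₀1 hY'1 hs0 hε₀ hεs hB₀'HY' hα₁L hcs0 hα₄0 hcB0
      (by rw [← hV']; linarith only [hα₄U, hV₄V']) (by rw [← hV']; linarith only [htU, hV₄V']) (by rw [← hV']; linarith only [hQU, hV₄V'])
      (by rw [← hV']; exact hsV') hCb₁ hC₂ hB4 hB5
  obtain ⟨Q, hQ⟩ : ∃ q : ℝ, q = ε₀ + 120 * cB + 8 * α₄ := ⟨_, rfl⟩
  obtain ⟨hQ11, hQℓ, hQY', hQX, hcsℓ2, hcsℓ1, hcs8, hcsB₀, hcs9, hα9, hε8ℓ, hε8, hℓXs, hs4, h3α₁, -, -⟩ :=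
    drops hℓ1 hX₀1 hB₀X hY'1 hc hcB9 hs0 hε₀ hεs hB1 hB3 hB4 hcs0 hcsL hcsU hα₁U hcB0 hα₄0 hQ
      (by rw [hQ, ← hV']; linarith only [hQU, hV₄V'])
  have hQ0 : 0 ≤ Q := by rw [hQ]; positivity
  have hQY : 10 ^ 11 * Y * Q ≤ 1 := by
    have := mul_le_mul_of_nonneg_right hYY' hQ0; linarith only [this, hQY']
  -- numerals of the constants
  obtain ⟨hC0, hc2', hc3, hC6, hC5', hC4G, hC2p⟩ := And.intro C0_three (And.intro (c2'_three L) (And.intro (c3_three L) (And.intro C6_three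
    (And.intro C5'_three (And.intro (C4G_three L) C2p_three)))))
  have hℓsq0 : 0 < 14336 * ℓ ^ 2 := by positivity
  have hℓ512 : 0 < 512 * ℓ := by positivity
  -- handy products
  set t : ℝ := 2 * (ℓ * cstar) + 8 * α₄ with htdef
  have ht0 : 0 ≤ t := by positivity
  have htQ : t ≤ Q := by rw [htdef, hQ, ← hcB]; linarith only [hε₀, hcB0]
  have hα₄Q : 8 * α₄ ≤ Q := by rw [hQ]; linarith only [hε₀, hcB0]
  have hcBQ : 120 * cB ≤ Q := by rw [hQ]; linarith only [hε₀, hα₄0]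
  have hℓt : ℓ * t ≤ ℓ * Q := mul_le_mul_of_nonneg_left htQ hℓ0
  have hXt : X₀ * t ≤ X₀ * Q := mul_le_mul_of_nonneg_left htQ hX₀0
  have hB₀t : B₀ * t ≤ X₀ * t := mul_le_mul_of_nonneg_right hB₀X ht0
  have hℓcB : ℓ * (120 * cB) ≤ ℓ * Q := mul_le_mul_of_nonneg_left hcBQ hℓ0
  have hℓα₄ : ℓ * (8 * α₄) ≤ ℓ * Q := mul_le_mul_of_nonneg_left hα₄Q hℓ0
  have hBRα₄ : BR * (8 * α₄) ≤ Y * Q := mul_le_mul hBRY hα₄Q (by positivity) hY0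
  have hℓℓ : ℓ ≤ ℓ ^ 2 := by nlinarith only [hℓ1]
  have hℓε : ℓ * ε₀ ≤ ℓ ^ 2 * ε₀ := mul_le_mul_of_nonneg_right hℓℓ hε₀.le
  have hα₄1 : α₄ ≤ 1 := by linarith only [hα₄Q, hQ11]
  -- the `Cb`∕`Cl` ceilings and the (1.103) shares
  have hℓYV : ℓ ^ 2 * Y * V₄ ≤ 1 / 10 ^ 21 := by
    rw [le_div_iff₀ (by norm_num : (0 : ℝ) < 10 ^ 21), hV₄]; linarith only [hB10]
  have hℓYV0 : 0 ≤ ℓ ^ 2 * Y * V₄ := by positivity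
  have hClB : Cl * B₀'H ≤ 1 / 2 := by
    have e := mul_le_mul hClU hB₀'HY hB₀'H.le (by positivity)
    linarith only [e, hℓYV]
  have hCb₂s : Cb₂ ≤ s / 2 := by
    have e : 4 * 10 ^ 21 * ℓ ^ 2 * V₄ ^ 2 = 4 * 10 ^ 21 * ((ℓ ^ 10 * X₀ ^ 2 * Y ^ 2 * n ^ 2 * s) * s) := by rw [hV₄]; ring
    have f := mul_le_mul_of_nonneg_right hB7 hs0.le
    rw [e] at hCb₂U
    linarith only [hCb₂U, f, hs0]
  have hCb0 : 0 ≤ Cb := by rw [hCb]; linarith only [hCb₁0, hCb₂0]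
  have hCbU : Cb ≤ 2 * s := by rw [hCb]; linarith only [hCb₁U, hCb₂s, hs0]
  have hYQC : Y * (579944448 * (120 * cB + α₄)) ≤ 1 / 160 := by
    have e : 120 * cB + α₄ ≤ Q := by rw [hQ]; linarith only [hε₀, hα₄0]
    have := mul_le_mul_of_nonneg_left e hY0
    linarith only [this, hQY]
  have hYsum : Y * (960 * ℓ * (α₄ + δ + 5 * ω)) ≤ 1 / 10 ^ 8 := by
    have e0 : α₄ + δ + 5 * ω ≤ 8 * 10 ^ 9 * ℓ * V₄ := by linarith only [hsum, hω0]
    have e1 := mul_le_mul_of_nonneg_left (mul_le_mul_of_nonneg_left e0 (by positivity : (0 : ℝ) ≤ 960 * ℓ)) hY0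
    have e2 : Y * (960 * ℓ * (8 * 10 ^ 9 * ℓ * V₄)) = 768 * 10 ^ 10 * (ℓ ^ 2 * Y * V₄) := by ring
    linarith only [e1, e2, hℓYV]
  have hCbρ' : 2 * B₀'H * Cb ≤ α₄ := by
    rw [hCb, hCb₁, hCb₂E]
    have e1 := mul_le_mul_of_nonneg_right hB₀'HY (by positivity : (0 : ℝ) ≤ 579944448 * (120 * cB + α₄))
    have e2 := mul_le_mul_of_nonneg_right hB₀'HY (by positivity : (0 : ℝ) ≤ 960 * ℓ * (α₄ + δ + 5 * ω))
    have f1 : 2 * B₀'H * (579944448 * (120 * cB + α₄) * α₄) = (2 * (B₀'H * (579944448 * (120 * cB + α₄)))) * α₄ := by ring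
    have f2 : 2 * B₀'H * (960 * ℓ * (α₄ + δ + 5 * ω) * α₄) = (2 * (B₀'H * (960 * ℓ * (α₄ + δ + 5 * ω)))) * α₄ := by ring
    have g1 := mul_le_mul_of_nonneg_right (by linarith only [e1, hYQC] : 2 * (B₀'H * (579944448 * (120 * cB + α₄))) ≤ 1 / 2) hα₄0.le
    have g2 := mul_le_mul_of_nonneg_right (by linarith only [e2, hYsum] : 2 * (B₀'H * (960 * ℓ * (α₄ + δ + 5 * ω))) ≤ 1 / 2) hα₄0.le
    linarith only [f1, f2, g1, g2]
  have hsh3' : ∀ τ : ℝ, τ ≤ τ₀ → BG * BR * (B₂' * Cb) ≤ α₄ / 64 := by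
    intro τ _
    rw [le_div_iff₀ (by norm_num : (0 : ℝ) < 64), hCb, hCb₁, hCb₂E]
    have e1 := mul_le_mul_of_nonneg_right hBGBRBY (by positivity : (0 : ℝ) ≤ 579944448 * (120 * cB + α₄))
    have e2 := mul_le_mul_of_nonneg_right hBGBRBY (by positivity : (0 : ℝ) ≤ 960 * ℓ * (α₄ + δ + 5 * ω))
    have g1 := mul_le_mul_of_nonneg_right (e1.trans hYQC) hα₄0.le
    have g2 := mul_le_mul_of_nonneg_right (e2.trans hYsum) hα₄0.le
    nlinarith only [g1, g2, hα₄0]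
  have hσbud : 10 ^ 7 * ℓ ^ 3 * (cstar + a₆₆) ≤ 1 := by
    have e1 := mul_le_mul_of_nonneg_left hcsU (by positivity : (0 : ℝ) ≤ ℓ ^ 3)
    have e1' := mul_le_mul_of_nonneg_left ha66U (by positivity : (0 : ℝ) ≤ ℓ ^ 3)
    have e2 : ℓ ^ 3 * (3390 * ℓ * X₀ * s) = 3390 * (ℓ ^ 4 * X₀ * 1 * 1 * s) := by ring
    have e3 : ℓ ^ 4 * X₀ * 1 * 1 * s ≤ ℓ ^ 5 * X₀ * Y * n * s := by gcongr; norm_num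
    have e4 : ℓ ^ 3 * 1 * 1 * 1 * s ≤ ℓ ^ 5 * X₀ * Y * n * s := by gcongr; norm_num
    linarith only [e1, e1', e2, e3, e4, hB9]
  have hmσ : 32 * m * σ ≤ 1 := by linarith only [le_of_eq hτ₀.symm, hτ₀U, hB9, show V₄ = ℓ ^ 4 * X₀ * Y * n * s from hV₄,
    (by have : ℓ ^ 4 * X₀ * Y * n * s ≤ ℓ ^ 5 * X₀ * Y * n * s := by gcongr; norm_num
        exact this : ℓ ^ 4 * X₀ * Y * n * s ≤ ℓ ^ 5 * X₀ * Y * n * s)]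
  have hr : 160 * (α₄ + δ + 11 * ω) ≤ 1 / 4 := by
    have e : ℓ * V₄ ≤ 1 / 10 ^ 13 := by
      rw [le_div_iff₀ (by norm_num : (0 : ℝ) < 10 ^ 13), hV₄]; linarith only [hB9]
    linarith only [hsum, e]
  -- assemble
  refine ⟨3 * (M' + ρ') + 1, ε₀, α₁, a₆₆, cstar, B₀', α₄, C₂, cB, cB, cDA, 2 * cstar, σ, δ, ω, Cb, Cl, τ₀, rfl, rfl, ha₆₆, ?_, ?_, ?_, ?_, ?_, hcB, hcB,
    ?_, rfl, ?_, ?_, ?_, ?_,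
    ⟨by omega, hε₀, by linarith only [hα₁L, hs0], by linarith only [hα₁L, hs0], by linarith only [ha66U, hα₁L], le_of_eq ha₆₆.symm, hB₀'0,
      hα₄0.le, hα₄0, hB₀.le, hcs0.le, hCb0, hCl0, by positivity, hcB0, hσ0, hδ0, hω0, hτ₀0⟩, ?_, ?_, ?_, ?_⟩
  · rw [hα₁, hs, hn]
  · rw [hcs]; push_cast; ring
  · rw [hB₀', hB₀'b, hm]
  · rw [hα₄, hcs]; push_cast; ring
  · rw [hC₂]; norm_num
  · rw [hcDA]; push_cast; ring
  · rw [hσ]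
  · rw [hδ]; push_cast; ring
  · rw [hω]; push_cast; ring
  · rw [hτ₀, hm]
  · -- (2) Theorem 4's windows
    refine ⟨by linarith only [hα₄Q, hQ11], by rw [← hcB]; linarith only [hcBQ, hQ11], by linarith only [ha66U, hs4],
      by linarith only [ha66U, hcsL, hs0], ?_, ?_, by linarith only [htQ, hQ11], by push_cast; linarith only [htQ, hQ11], ?_, ?_, ?_,
      by push_cast; linarith only [htQ, hQ11], ?_, by push_cast; linarith only [h61a]⟩
    · rw [hC0]; linarith only [hε8]
    · rw [hc2', le_div_iff₀ hℓsq0]; linarith only [hε8ℓ]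
    · push_cast; exact hsmall_window hε₀.le hε8 ht0 (by linarith only [htQ, hQ11])
    · rw [hc3, le_div_iff₀ hℓ512]; linarith only [hℓt, hQℓ]
    · push_cast; linarith only [hB₀t, hXt, hQX]
    · push_cast; rw [hC₂]; exact hC2_window hε₀.le hε8
  · -- (3) `topRows_of_datum`'s scalar windows
    refine ⟨hα9, hcs9, by push_cast; linarith only [hcsB₀], by push_cast; linarith only [h61b], by push_cast; linarith only [h3α₁],
      le_of_eq hcB.symm, le_of_eq hcB.symm, ?_, ?_, ?_, by push_cast; linarith only [hcBQ, hQ11], by push_cast; linarith only [hcBQ, hQ11],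
      ?_, ?_, ?_, ?_, ?_, ?_, ?_, ?_, by linarith only [hcBQ, hQ11], ?_, ?_, ?_, ?_, ?_, hClB⟩
    · rw [hcDA]; push_cast; exact le_rfl
    · push_cast; exact hsmall_window hε₀.le hε8 hcB0 (by linarith only [hcBQ, hQ11])
    · rw [hc3, le_div_iff₀ hℓ512]; linarith only [hℓcB, hQℓ]
    · rw [hC6]; linarith only [hα₄Q, hQ11]
    · push_cast; linarith only [hℓα₄, hQℓ]
    · rw [hC4G]; push_cast
      have e := mul_nonneg hℓ0 hQ0
      have hQ' : ε₀ + 40 * 3 * cB + 4 * (2 * α₄) = Q := by rw [hQ]; ring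
      rw [hQ']
      linarith only [hQℓ, hQ11, e]
    · push_cast; linarith only [hε8ℓ]
    · push_cast; rw [hC6]; linarith only [hε8ℓ]
    · push_cast; rw [hC5', hC6]; linarith only [hε8ℓ]
    · push_cast; rw [hC6]; linarith only [hℓε, hε8ℓ]
    · rw [hC6]; push_cast; linarith only [hcBQ, hα₄Q, hQ11]
    · rw [hC2p, hCb]; push_cast
      have : (579944448 : ℝ) * (40 * 3 * cB + α₄) * α₄ = Cb₁ := by rw [hCb₁]; ring
      linarith only [this, hCb₂0]
    · rw [hCb, hCb₂]; linarith only [hCb₁0]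
    · rw [hC2p, hCl]; push_cast
      have p : 0 ≤ 10240 * (3 * ℓ) * (α₄ + δ + 11 * ω) := by positivity
      nlinarith only [p]
    · rw [hCl]; push_cast
      have p : 0 ≤ 2 * (579944448 : ℝ) * (120 * cB + 2 * α₄) := by positivity
      nlinarith only [p]
    · rw [le_div_iff₀ (by positivity : (0 : ℝ) < 2 * B₀'H)]; linarith only [hCbρ']
  · -- (4) `hSupBlock_of_topRows`' windows, J3's, the (K-DE) windows
    refine ⟨by linarith only [hα₄Q, hQ11], by linarith only [hcBQ, hQ11], ?_,
      fun η hη0 hη1 => exp_mul_sub_one_le hη0 hη1 hcs0.le (by linarith only [hcs8]), by rw [hC0]; linarith only [hε8],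
      by rw [hc2', le_div_iff₀ hℓsq0]; linarith only [hε8ℓ], by linarith only [ha66U, hs4],
      by linarith only [hσL, mul_le_mul_of_nonneg_right hℓ1 hcs0.le], hσL, hσLa, ?_, ?_, ?_, hr⟩
    · push_cast; linarith only [hcsℓ2]
    · intro η hη0 hη1
      have h1 : ℓ * cstar ≤ 1 := by linarith only [hcsℓ1]
      exact (exp_mul_sub_one_le hη0 hη1 (by positivity) h1).trans (mul_le_mul_of_nonneg_left (by linarith only [hσL]) hη0)
    · push_cast; rw [hσ]; linarith only [hσbud]
    · rw [← hm]; exact hmσ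
  · -- (5) the seven top windows
    intro τ hτ0 hττ₀
    have hτ1 : B₀'H * τ ≤ 32 * ℓ * m * B₀'H * (cstar + a₆₆) := by
      have := mul_le_mul_of_nonneg_left (hττ₀.trans (le_of_eq hτ₀E)) hB₀'H.le; linarith only [this]
    have hBτlt : B₀'H * τ < α₄ / 4 := lt_of_le_of_lt hτ1 hsh3
    have hBτ' : B₀'H * τ ≤ α₄ / 4 := hBτlt.le
    have hQY'' : 10 ^ 11 * Y * (120 * cB + 8 * α₄) ≤ 1 := by
      have e := mul_le_mul_of_nonneg_left (by rw [hQ]; linarith only [hε₀] : 120 * cB + 8 * α₄ ≤ Q) hY0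
      linarith only [e, hQY]
    refine ⟨hBτlt, by linarith only [hBτ', hCbρ', hα₄Q, hQ11], by linarith only [hBτ', hCbρ', hα₄Q, hQ11], ?_,
      by linarith only [hBτ', hCbρ'], ?_, ?_⟩
    · have e : (α₄ / 4 + B₀'H * (Cb + τ)) * BR ≤ α₄ * Y :=
        mul_le_mul (by linarith only [hBτ', hCbρ']) hBRY hBR hα₄0.le
      linarith only [e, hBRα₄, hQY, mul_le_mul_of_nonneg_left hα₄Q hY0]
    · exact top103₃ hBG hBR hB₀'H hY0 hBGBRY hα₄0 hcB0 hCb0 hCbρ' hsh1 (hsh2 τ hττ₀) (hsh3' τ hττ₀) hQY'' hτ0 hBτ'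
    · have hs'' : 0 < ℓ * m * (cstar + a₆₆) / 2 := by positivity
      have hcsaU : cstar + a₆₆ ≤ 3588 * ℓ * X₀ * s := by
        have : s ≤ ℓ * X₀ * s := by
          have := mul_nonneg (sub_nonneg.mpr (one_le_mul_of_one_le_of_one_le hℓ1 hX₀1)) hs0.le; linarith only [this]
        linarith only [hcsU, ha66U, this]
      have hsV'' : ℓ * m * (cstar + a₆₆) / 2 ≤ V' := by
        have e1 : ℓ * m * (cstar + a₆₆) ≤ ℓ * (3 * n) * (3588 * ℓ * X₀ * s) :=
          mul_le_mul (mul_le_mul_of_nonneg_left hm3 hℓ0) hcsaU (by positivity) (by positivity)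
        have e2 : ℓ * (3 * n) * (3588 * ℓ * X₀ * s) = 10764 * (ℓ ^ 2 * X₀ * 1 * n * s) := by ring
        have p : 0 ≤ ℓ ^ 2 * X₀ * 1 * n * s := by positivity
        have e3 : 16 * (ℓ ^ 2 * X₀ * 1 * n * s) ≤ ℓ ^ 4 * (ℓ ^ 2 * X₀ * Y * n * s) := by
          have f1 := mul_le_mul_of_nonneg_right hℓ4 (by positivity : (0 : ℝ) ≤ ℓ ^ 2 * X₀ * 1 * n * s)
          have f2 : ℓ ^ 2 * X₀ * 1 * n * s ≤ ℓ ^ 2 * X₀ * Y * n * s := by gcongr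
          have f3 := mul_le_mul_of_nonneg_left f2 (by positivity : (0 : ℝ) ≤ ℓ ^ 4)
          linarith only [f1, f3]
        have e4 : V' = 400 * (ℓ ^ 4 * (ℓ ^ 2 * X₀ * Y * n * s)) := by rw [hV'E, hV₄]; ring
        rw [div_le_iff₀ (by norm_num : (0 : ℝ) < 2)]
        linarith only [e1, e2, e3, e4, p]
      have hCbs'' : Cb ≤ ℓ * m * (cstar + a₆₆) / 2 := by
        have e : cstar ≤ ℓ * m * cstar := by
          have := mul_le_mul_of_nonneg_right (one_le_mul_of_one_le_of_one_le hℓ1 hm1) hcs0.le; linarith only [this]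
        have e' : 0 ≤ ℓ * m * a₆₆ := by positivity
        rw [le_div_iff₀ (by norm_num : (0 : ℝ) < 2)]
        linarith only [hCbU, hcsL, e, e', hcs0]
      have hτs'' : τ ≤ 64 * (ℓ * m * (cstar + a₆₆) / 2) := by linarith only [hττ₀, hτ₀E]
      exact top106 hBR hB₂' hB₀'H hY1 hB₂'Y hBGY hBRY hs'' hsV'' hα₄0 hα₄1 (by linarith only [hα₄U, hV₄V']) hcB0 (hcBV₄.trans (by linarith only [hV₄V'']))
        hcDA0 (hcDAV₄.trans (by linarith only [hV₄V''])) hCb0 hCbs'' hCbρ' hCl0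
        (by rw [hV'E]; linarith only [hClU, (by positivity : (0 : ℝ) ≤ ℓ ^ 2 * V₄)]) hClB (by rw [hV']; exact hB6)
        hτ0 hτs'' hBτ'

end Summit.QuantumFields.YangMills.Theorems.HalvingHSupURhoWindowsRho3

end
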